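import Mathlib.FieldTheory.Galois.Profinite
import Literature.AlgebraicGeometry.Frobenioids.QuasiTemperoidGaloisFieldsEquivalence
import Literature.AlgebraicGeometry.Frobenioids.FinSubextCat
import Literature.AlgebraicGeometry.Frobenioids.BCatOrbits
import Literature.AnabelianGeometry.SemiGraphs.ChartFiniteObjects
import HarnessLib

/-!
# Frobenioids I, Examples 6.1/6.3: `B(G)⁰` "thought of as `Spec L`" — Grothendieck's Galois
# correspondence `B(Gal(F̄/F))⁰ ≌ FinSubextCat F F̄` (CONSTRUCTION + equivalence)

Mochizuki, *The geometry of Frobenioids I*, Kyushu J. Math. **62** (2008), Example 6.1 p. 109 / Example 6.3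
p. 113 [cite: MochizukiFrdI2008, Ex. 6.3 p.113]: "`D`" is "the subcategory of connected objects `B(G)⁰` of the
Galois category `B(G)`" of a profinite group `G = Gal(F̃/F)`, whose objects "may be thought of as schemes
`Spec(L)`, where `L ⊆ F̃` is a finite extension of `F`"; and *Frobenioids II*, Example 1.3 (iii) p. 12
"[cf. Example 1.1, (ii)]" [cite: MochizukiFrdII2008, Ex 1.3 (iii) pp.11-12] (the same identification for the
tempered category `B^temp(G_F)⁰`).

The tree carries BOTH sides of this identification as separate categories: abc-iut-L1's
`FinSubextCat F K` (finite subextensions of `K/F`, arrows `Spec L → Spec M` = `F`-algebra maps `M → L`;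
the base of the arithmetic Frobenioid of Example 6.3, `ArithmeticFrobenioidModel.lean`) and the
`G`-set side `ConnectedPart (BCat G)` (= [IUTchI] Example 5.1's `†𝒟^⊛ := ℬ(π₁(†𝒟^⊛))⁰`,
`Literature.IUT.HodgeTheaters.BaseCat`).  This file CONSTRUCTS the identification as functors and proves
they are equivalences (classical Galois theory over Mathlib; abc-iut-w4-d018's
`QuasiTemperoid.galoisFields` — the `B^temp(G_F)⁰ ⥤ FinEtale F` form — supplies all the field-theoretic
steps, which are reused by name, not re-proved):

* `BCat.connectedToBTemp G : ConnectedPart (BCat G) ⥤ ConnectedPart (BTemp G)` — a connected finite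
  continuous `G`-set IS a connected tempered `G`-set (abc-iut-L3's `toBTemp` on connected parts); full and
  faithful for every topological group, essentially surjective — hence an equivalence — for COMPACT `G`
  (a single orbit with open stabiliser in a compact group is finite; the inverse on objects is L3's
  `BTemp.toContAction`);
* `QuasiTemperoid.galoisSubext F : ConnectedPart (BTemp (GalFbar F)) ⥤ FinSubextCat F (Fbar F)` —
  `X ↦ Spec F̄^{Stab(x_X)}` as an INTERMEDIATE FIELD of `F̄` (same object function `fixFld`, same arrows
  `fieldMap` as `galoisFields F`, which it recovers after forgetting the embedding into `F̄`:
  `galoisSubext_forget`); full, faithful, essentially surjective — an equivalence — for `F` perfect;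
* `QuasiTemperoid.galoisSubextOfFinite F := connectedToBTemp ⋙ galoisSubext F :
  ConnectedPart (BCat (GalFbar F)) ⥤ FinSubextCat F (Fbar F)` — the identification of Example 6.3 itself,
  an equivalence for `F` perfect (`GalFbar F = Gal(F̄/F)` is compact).

Consumer: the instantiation of [IUTchI] Example 5.1 (ii)'s divisor data on `†𝒟^⊛ = ℬ(G_F)⁰` by the
arithmetic divisor functors of Example 6.3 (`Literature.IUT.HodgeTheaters`, companion file).  No statement of
either paper is strengthened; nothing here bears on [IUTchIII].
-/

noncomputable section

namespace Literature.AlgebraicGeometry.Frobenioids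

open CategoryTheory Topology
open Literature.AnabelianGeometry.SemiGraphs

universe u

/-! ### Connected finite `G`-sets are connected tempered `G`-sets -/

namespace BCat

variable (G : Type u) [Group G] [TopologicalSpace G] [IsTopologicalGroup G]

/-- A connected (= single-orbit, `BCat.isConnectedObj_iff`) finite continuous `G`-set is a connected object
of `B^temp(G)` (`BTempConnected.isConnectedObj_of_transitive`): abc-iut-L3's `toBTemp` restricted to the
connected parts, `B(G)⁰ ⥤ B^temp(G)⁰`. [cite: MochizukiFrdI2008, Ex. 6.1 p.109] -/
def connectedToBTemp : ConnectedPart (BCat G) ⥤ ConnectedPart (BTemp G) :=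
  ObjectProperty.lift _ (ObjectProperty.ι _ ⋙ toBTemp G) fun X => by
    obtain ⟨x₀, htr⟩ := (BCat.isConnectedObj_iff X.obj).mp X.property
    exact QuasiTemperoid.BTempConnected.isConnectedObj_of_transitive _ x₀ fun x => htr x

variable {G}

/-- On underlying sets `connectedToBTemp` is the identity. [cite: MochizukiFrdI2008, Ex. 6.1 p.109] -/
theorem connectedToBTemp_obj_V (X : ConnectedPart (BCat G)) :
    ((connectedToBTemp G).obj X).obj.obj.V = X.obj.obj.V := rfl

/-- … with the same action. [cite: MochizukiFrdI2008, Ex. 6.1 p.109] -/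
theorem connectedToBTemp_obj_ρ (X : ConnectedPart (BCat G)) (g : G) (x : X.obj.obj.V) :
    ((connectedToBTemp G).obj X).obj.obj.ρ g x = (X.obj.obj.ρ g).hom x := rfl

/-- … and the same underlying maps. [cite: MochizukiFrdI2008, Ex. 6.1 p.109] -/
theorem connectedToBTemp_map_apply {X Y : ConnectedPart (BCat G)} (f : X ⟶ Y) (x : X.obj.obj.V) :
    (((connectedToBTemp G).map f).hom.hom.hom x : Y.obj.obj.V) = f.hom.hom.hom x := rfl

variable (G)

/-- `B(G)⁰ ⥤ B^temp(G)⁰` is faithful (same underlying maps). [cite: MochizukiFrdI2008, Ex. 6.1 p.109] -/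
theorem connectedToBTemp_faithful : (connectedToBTemp G).Faithful where
  map_injective := by
    intro X Y f f' h
    apply ObjectProperty.hom_ext
    apply BCat.hom_ext_apply
    intro x
    rw [← connectedToBTemp_map_apply f x, ← connectedToBTemp_map_apply f' x, h]

/-- `B(G)⁰ ⥤ B^temp(G)⁰` is full (a `G`-map of the underlying sets is a morphism of `B(G)`).
[cite: MochizukiFrdI2008, Ex. 6.1 p.109] -/
theorem connectedToBTemp_full : (connectedToBTemp G).Full where
  map_surjective := by
    intro X Y φ
    refine ⟨ObjectProperty.homMk (ObjectProperty.homMk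
      { hom := FintypeCat.homMk fun x => (φ.hom.hom.hom x : Y.obj.obj.V)
        comm := fun g => ?_ }), ?_⟩
    · apply FintypeCat.hom_ext
      intro x
      simp only [FintypeCat.comp_apply, FintypeCat.homMk_apply]
      exact QuasiTemperoid.BTempConnected.hom_ρ φ.hom g x
    · apply ObjectProperty.hom_ext
      apply QuasiTemperoid.BTempConnected.hom_ext_apply
      intro x
      rfl

/-- `B(G)⁰ ⥤ B^temp(G)⁰` is essentially surjective for COMPACT `G`: a connected tempered `G`-set is one orbit
`G/Stab(x)` with `Stab(x)` open, hence of finite index, so it is finite — an object of `B(G)` (abc-iut-L3's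
`BTemp.toContAction`), connected again as a single orbit. [cite: MochizukiFrdI2008, Ex. 6.1 p.109] -/
theorem connectedToBTemp_essSurj [CompactSpace G] : (connectedToBTemp G).EssSurj where
  mem_essImage T := by
    classical
    letI : MulAction G T.obj.obj.V := Action.instMulAction T.obj.obj
    obtain ⟨x₀⟩ := QuasiTemperoid.BTempConnected.nonempty_of_isConnectedObj T.obj T.property
    have htr := QuasiTemperoid.BTempConnected.exists_ρ_eq_of_isConnectedObj T.obj T.property x₀
    have hstab : IsOpen (MulAction.stabilizer G x₀ : Set G) := by
      have : (MulAction.stabilizer G x₀ : Set G) = {g : G | T.obj.obj.ρ g x₀ = x₀} := by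
        ext g
        simp only [SetLike.mem_coe, MulAction.mem_stabilizer_iff, Set.mem_setOf_eq]
        rfl
      rw [this]
      exact T.obj.property.2 x₀
    haveI := Subgroup.quotient_finite_of_isOpen _ hstab
    have horb : ∀ x : T.obj.obj.V, x ∈ MulAction.orbit G x₀ := fun x => by
      obtain ⟨g, hg⟩ := htr x
      exact ⟨g, hg⟩
    haveI : Finite (MulAction.orbit G x₀) :=
      Finite.of_equiv _ (MulAction.orbitEquivQuotientStabilizer G x₀).symm
    haveI : Finite T.obj.obj.V :=
      Finite.of_surjective (fun y : MulAction.orbit G x₀ => (y : T.obj.obj.V))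
        fun x => ⟨⟨x, horb x⟩, rfl⟩
    let X₀ : BCat G := BTemp.toContAction T.obj
    have hX₀ : IsConnectedObj X₀ :=
      BCat.isConnectedObj_of_transitive X₀ x₀ fun x => htr x
    exact ⟨⟨X₀, hX₀⟩, ⟨(connectedObjects (BTemp G)).isoMk (BTemp.toBTempToContActionIso T.obj)⟩⟩

/-- **`B(G)⁰ ≌ B^temp(G)⁰` for compact `G`** (e.g. profinite `G = Gal(F̃/F)`): `connectedToBTemp G` is an
equivalence of categories. [cite: MochizukiFrdI2008, Ex. 6.1 p.109] -/
theorem connectedToBTemp_isEquivalence [CompactSpace G] : (connectedToBTemp G).IsEquivalence :=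
  haveI := connectedToBTemp_faithful G
  haveI := connectedToBTemp_full G
  haveI := connectedToBTemp_essSurj G
  {}

end BCat

/-! ### `B^temp(G_F)⁰ ⥤ FinSubextCat F F̄`: the fixed fields as intermediate fields of `F̄` -/

namespace QuasiTemperoid

variable (F : Type u) [Field F]

/-- Forgetting the embedding into `K`: a finite subextension `F ⊆ L ⊆ K` as an abstract finite separable
extension of `F` (`F` perfect), `FinSubextCat F K ⥤ FinEtale F` (same arrows: `F`-algebra maps).
[cite: MochizukiFrdI2008, Ex. 6.3 p.113] -/
def FinSubextCat.toFinEtale [PerfectField F] (K : Type u) [Field K] [Algebra F K] :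
    FinSubextCat F K ⥤ FinEtale F where
  obj X := @FinEtale.mk F _ X.L _ _ X.fin inferInstance
  map f := ⟨f.toAlgHom⟩

/-- `toFinEtale` is faithful (it is the identity on arrows). [cite: MochizukiFrdI2008, Ex. 6.3 p.113] -/
theorem FinSubextCat.toFinEtale_faithful [PerfectField F] (K : Type u) [Field K] [Algebra F K] :
    (FinSubextCat.toFinEtale F K).Faithful :=
  ⟨fun h => FinSubextCat.hom_ext (congrArg FinEtale.Hom.alg h)⟩

/-- The object `Spec F̄^{Stab(x_X)}` of `FinSubextCat F F̄`: the fixed field of the stabiliser of the base point,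
as an intermediate field of `F̄` (finite over `F` by Krull's correspondence, `finiteDimensional_fixFld`).
[cite: MochizukiFrdII2008, Ex 1.3 (iii) pp.11-12] -/
def subextObj [PerfectField F] (X : ConnectedPart (BTemp (GalFbar F))) : FinSubextCat F (Fbar F) :=
  @FinSubextCat.mk F _ (Fbar F) _ _ (fixFld F X) (finiteDimensional_fixFld F X)

/-- **The Galois-correspondence functor `B^temp(G_F)⁰ ⥤ FinSubextCat F F̄`** ("[cf. Example 1.1, (ii)]",
FrdII p. 12; FrdI Ex. 6.1 p. 109 "thought of as `Spec(L)`, `L ⊆ F̃`"): `X ↦ Spec F̄^{Stab(x_X)}`,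
`f ↦ (a ↦ g_f · a)` — abc-iut-w4-d018's `galoisFields F` with the embedding into `F̄` remembered.
[cite: MochizukiFrdII2008, Ex 1.3 (iii) pp.11-12] -/
def galoisSubext [PerfectField F] : ConnectedPart (BTemp (GalFbar F)) ⥤ FinSubextCat F (Fbar F) where
  obj X := subextObj F X
  map f := ⟨fieldMap f⟩
  map_id X := FinSubextCat.hom_ext (AlgHom.ext fun a => Subtype.ext (fieldMap_id_apply X a))
  map_comp f h := FinSubextCat.hom_ext (AlgHom.ext fun a => Subtype.ext (fieldMap_comp_apply f h a).symm)

/-- The intermediate field of `galoisSubext F X` is `F̄^{Stab(x_X)}`. [cite: MochizukiFrdII2008, Ex 1.3 (iii) pp.11-12] -/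
theorem galoisSubext_obj_L [PerfectField F] (X : ConnectedPart (BTemp (GalFbar F))) :
    ((galoisSubext F).obj X).L = fixFld F X := rfl

/-- The arrow of `galoisSubext F f` is `fieldMap f` (`a ↦ g_f · a`). [cite: MochizukiFrdII2008, Ex 1.3 (iii) pp.11-12] -/
theorem galoisSubext_map_toAlgHom [PerfectField F] {X Y : ConnectedPart (BTemp (GalFbar F))} (f : X ⟶ Y) :
    ((galoisSubext F).map f).toAlgHom = fieldMap f := rfl

/-- Forgetting the embedding recovers `galoisFields F` on the nose. [cite: MochizukiFrdII2008, Ex 1.3 (iii) pp.11-12] -/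
theorem galoisSubext_forget [PerfectField F] :
    galoisSubext F ⋙ FinSubextCat.toFinEtale F (Fbar F) = galoisFields F := rfl

/-- `galoisSubext F` is faithful (because `galoisFields F` is). [cite: MochizukiFrdII2008, Ex 1.3 (iii) pp.11-12] -/
theorem galoisSubext_faithful [PerfectField F] : (galoisSubext F).Faithful :=
  haveI : (galoisSubext F ⋙ FinSubextCat.toFinEtale F (Fbar F)).Faithful := galoisFields_faithful F
  Functor.Faithful.of_comp _ (FinSubextCat.toFinEtale F (Fbar F))

/-- `galoisSubext F` is full (because `galoisFields F` is and the forgetful functor is faithful).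
[cite: MochizukiFrdII2008, Ex 1.3 (iii) pp.11-12] -/
theorem galoisSubext_full [PerfectField F] : (galoisSubext F).Full :=
  haveI : (galoisSubext F ⋙ FinSubextCat.toFinEtale F (Fbar F)).Full := galoisFields_full F
  haveI := FinSubextCat.toFinEtale_faithful F (Fbar F)
  Functor.Full.of_comp_faithful _ (FinSubextCat.toFinEtale F (Fbar F))

/-- **`galoisSubext F` is essentially surjective**: a finite subextension `F ⊆ L ⊆ F̄` is, in `FinSubextCat F F̄`,
isomorphic to the fixed field of (a conjugate of) `Gal(F̄/L)`, i.e. to `galoisSubext` of the coset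
`G_F`-set `G_F/Gal(F̄/L)`. [cite: MochizukiFrdII2008, Ex 1.3 (iii) pp.11-12] -/
theorem galoisSubext_essSurj [PerfectField F] : (galoisSubext F).EssSurj := by
  haveI : IsGalois F (Fbar F) := {}
  refine ⟨fun Y => ?_⟩
  let K' : IntermediateField F (Fbar F) := Y.L
  haveI hK' : FiniteDimensional F K' := Y.fin
  -- `H := Gal(F̄/K')`, open; the `G_F`-set `G_F/H`
  let H : Subgroup (GalFbar F) := K'.fixingSubgroup
  have hH : IsOpen (H : Set (GalFbar F)) := (InfiniteGalois.isOpen_iff_finite K').mpr hK'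
  let T : BTemp (GalFbar F) := cosetObj (GalFbar F) (isTempered_galFbar F) H hH
  have hρ : ∀ (g : GalFbar F) (c : GalFbar F ⧸ H), (T.obj.ρ g c : GalFbar F ⧸ H) = g • c := fun _ _ => rfl
  have htr : ∀ c : T.obj.V, ∃ g : GalFbar F, T.obj.ρ g ((1 : GalFbar F) : GalFbar F ⧸ H) = c := by
    intro c
    obtain ⟨g, rfl⟩ := QuotientGroup.mk_surjective c
    exact ⟨g, by rw [hρ, MulAction.Quotient.smul_coe, smul_eq_mul, mul_one]⟩
  let X : ConnectedPart (BTemp (GalFbar F)) := ⟨T, BTempConnected.isConnectedObj_of_transitive T _ htr⟩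
  -- its base point is some coset `τH`; its stabiliser is `τHτ⁻¹`
  obtain ⟨τ, hτ⟩ := QuotientGroup.mk_surjective (basePt X)
  have hstab : stabilizerSubgroup X.obj (basePt X) = H.map (MulAut.conj τ).toMonoidHom := by
    ext g
    rw [mem_stabilizerSubgroup_iff]
    change g • (show GalFbar F ⧸ H from basePt X) = (show GalFbar F ⧸ H from basePt X) ↔ _
    rw [← hτ, ← MulAction.mem_stabilizer_iff]
    have hτ1 : ((τ : GalFbar F) : GalFbar F ⧸ H) = τ • ((1 : GalFbar F) : GalFbar F ⧸ H) := by
      rw [MulAction.Quotient.smul_coe, smul_eq_mul, mul_one]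
    rw [hτ1, MulAction.stabilizer_smul_eq_stabilizer_map_conj, MulAction.stabilizer_quotient]
  -- the field of `X` is `τ(K')`; `K' ≅ F̄^{Stab(x_X)}` by `a ↦ τ a`
  have hfwd : ∀ a ∈ K', τ a ∈ fixFld F X := by
    intro a ha
    rw [fixFld, hstab, mem_fixedField_map_conj_iff, AlgEquiv.symm_apply_apply,
      InfiniteGalois.fixedField_fixingSubgroup]
    exact ha
  have hbwd : ∀ a ∈ fixFld F X, τ.symm a ∈ K' := by
    intro a ha
    rw [fixFld, hstab, mem_fixedField_map_conj_iff, InfiniteGalois.fixedField_fixingSubgroup] at ha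
    exact ha
  let fwd : K' →ₐ[F] fixFld F X := restrictBetween τ K' (fixFld F X) hfwd
  let bwd : fixFld F X →ₐ[F] K' := restrictBetween τ.symm (fixFld F X) K' hbwd
  -- the isomorphism `galoisSubext X ≅ Spec K'` in `FinSubextCat F F̄`
  refine ⟨X, ⟨{ hom := ⟨fwd⟩, inv := ⟨bwd⟩, hom_inv_id := ?_, inv_hom_id := ?_ }⟩⟩
  · exact FinSubextCat.hom_ext (AlgHom.ext fun a => Subtype.ext (τ.apply_symm_apply (a : Fbar F)))
  · exact FinSubextCat.hom_ext (AlgHom.ext fun a => Subtype.ext (τ.symm_apply_apply (a : Fbar F)))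

/-- **FrdII Example 1.3 (iii) / FrdI Example 6.1: `galoisSubext F : B^temp(G_F)⁰ ⥤ FinSubextCat F F̄` is an
EQUIVALENCE of categories** (`F` perfect). [cite: MochizukiFrdII2008, Ex 1.3 (iii) pp.11-12] -/
theorem isEquivalence_galoisSubext [PerfectField F] : (galoisSubext F).IsEquivalence :=
  haveI := galoisSubext_faithful F
  haveI := galoisSubext_full F
  haveI := galoisSubext_essSurj F
  {}

/-! ### `B(G_F)⁰ ≌ FinSubextCat F F̄` (FrdI Example 6.3's "`D = B(G)⁰`, objects `Spec L`") -/

/-- **FrdI Examples 6.1/6.3 — `D = B(Gal(F̄/F))⁰` "thought of as `Spec(L)`, `L ⊆ F̄` finite over `F`"**: the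
composite `B(G_F)⁰ ⥤ B^temp(G_F)⁰ ⥤ FinSubextCat F F̄`, a connected finite continuous `G_F`-set `X ↦ Spec F̄^{Stab(x_X)}`.
[cite: MochizukiFrdI2008, Ex. 6.3 p.113] -/
def galoisSubextOfFinite [PerfectField F] : ConnectedPart (BCat (GalFbar F)) ⥤ FinSubextCat F (Fbar F) :=
  BCat.connectedToBTemp (GalFbar F) ⋙ galoisSubext F

/-- The intermediate field of `galoisSubextOfFinite F X` is the fixed field of the stabiliser of the base point of
`X` (viewed in `B^temp`). [cite: MochizukiFrdI2008, Ex. 6.3 p.113] -/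
theorem galoisSubextOfFinite_obj_L [PerfectField F] (X : ConnectedPart (BCat (GalFbar F))) :
    ((galoisSubextOfFinite F).obj X).L = fixFld F ((BCat.connectedToBTemp (GalFbar F)).obj X) := rfl

/-- **`galoisSubextOfFinite F : B(G_F)⁰ ⥤ FinSubextCat F F̄` is an EQUIVALENCE** (`F` perfect; `G_F` is compact,
Mathlib's profiniteness of `Gal(F̄/F)`). [cite: MochizukiFrdI2008, Ex. 6.3 p.113] -/
theorem isEquivalence_galoisSubextOfFinite [PerfectField F] : (galoisSubextOfFinite F).IsEquivalence := by
  haveI : IsGalois F (Fbar F) := {}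
  haveI := BCat.connectedToBTemp_isEquivalence (GalFbar F)
  haveI := isEquivalence_galoisSubext F
  exact Functor.isEquivalence_trans _ _

end QuasiTemperoid

end Literature.AlgebraicGeometry.Frobenioids

end
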